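import Mathlib
import Summits.ResolutionOfSingularities.ResolutionOfSingularities.Theorems.RisoStrataRisoCentresResolvePlumbing
import Literature.AlgebraicGeometry.Resolution.RegularLocusPerfectField

/-!
# Route RisoStrata — crux `RisoCentresResolve` (stmt-ResolutionOfSingularities-18546), line `Sketch`:
# stub `stub_rcrPersist` (persistence of the local ring at the centre under admissible charts)

Once the local ring `risoLoc O B = B_{𝔪_O ∩ B}` of a finitely generated chart `B ⊆ O` at the
centre of the valuation ring `O` is regular, an admissible blow-up chart
`risoStep P B d x = B[Cen/x]` (`Cen = risoCen P B d`, `x ∈ Cen` of minimal value) does not change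
it: `risoLoc O (risoStep P B d x) = risoLoc O B`. Generic in the cut predicate `P`.

Proof sketch.
* The centre `𝔭 = 𝔪_O ∩ B` (`subringCentre`) is a point of the regular locus `Reg(B) ⊆ Spec B`,
  since `risoLoc O B` is `B_𝔭` (`isRegularLocalRing_risoLoc_iff`, plumbing).
* `B` is of finite type over the algebraically closed, hence perfect, field `k`, so `Reg(B)` is
  open (`isOpen_regularLocus_of_perfectField`, tree); pick a basic open `𝔭 ∈ D(f) ⊆ Reg(B)`
  (`PrimeSpectrum.isTopologicalBasis_basic_opens`). As `f ∉ 𝔭`, `f` is a unit of `O`.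
* Every maximal ideal `m` cut out by the centre ideal `Cen` is singular, so `m ∉ D(f)`, i.e.
  `f ∈ m`; hence `f ∈ Cen = ⋂ m`.
* Admissibility gives `f · x⁻¹ ∈ O`, so `x⁻¹ ∈ O`: the denominator `x ∈ Cen ⊆ B` is a unit of
  `O`, whence `B ≤ risoStep P B d x ≤ risoLoc O B` (`risoStep_le_risoLoc`) and the sandwich rule
  `risoLoc_eq_of_le_of_le` concludes.
-/

noncomputable section

set_option linter.dupNamespace false -- mandated namespace of this single-conjunct summit

namespace Summit.ResolutionOfSingularities.ResolutionOfSingularities.Theorems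

open Literature.AlgebraicGeometry.Resolution

/-- **A regular centre has a regular basic open neighbourhood.** For a finitely generated
`k`-subalgebra `B ⊆ O` (`k` algebraically closed) whose local ring at the centre of `O` is regular,
some `f ∈ B` of value `1` (i.e. `f ∉ 𝔪_O ∩ B`) has `D(f) ⊆ Reg(B)`: the regular locus of `B` is
open. [folklore] -/
theorem persist_exists_basicOpen_subset_regularLocus {k K : Type} [Field k] [IsAlgClosed k]
    [Field K] [Algebra k K] {O : ValuationSubring K} {B : Subalgebra k K} (hB : B.FG)
    (hBO : B.toSubring ≤ O.toSubring) (hreg : IsRegularLocalRing ↥(risoLoc O B)) :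
    ∃ f : ↥B, O.valuation (f : K) = 1 ∧
      (PrimeSpectrum.basicOpen f : Set (PrimeSpectrum ↥B)) ⊆ regularLocus ↥B := by
  haveI : Algebra.FiniteType k ↥B := (Subalgebra.fg_iff_finiteType B).mp hB
  -- the centre `𝔪_O ∩ B` as a point of `Spec B`
  let p : PrimeSpectrum ↥B :=
    ⟨subringCentre B.toSubring O hBO, subringCentre.isPrime B.toSubring O hBO⟩
  have hp : p ∈ regularLocus ↥B := (isRegularLocalRing_risoLoc_iff hBO).mp hreg
  obtain ⟨v, ⟨f, rfl⟩, hpf, hfU⟩ :=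
    PrimeSpectrum.isTopologicalBasis_basic_opens.exists_subset_of_mem_open hp
      (isOpen_regularLocus_of_perfectField k ↥B)
  refine ⟨f, ?_, hfU⟩
  have hfp : f ∉ subringCentre B.toSubring O hBO := (PrimeSpectrum.mem_basicOpen f p).mp hpf
  exact valuation_eq_one_of_not_mem_subringCentre hBO hfp

/-- **An element `f` with `D(f) ⊆ Reg(B)` lies in the centre ideal**: every maximal ideal `m` cut
out by `risoCen P B d` is singular, hence `m ∉ D(f)`, i.e. `f ∈ m`. [folklore] -/
theorem persist_mem_risoCen_of_basicOpen_subset {k K : Type} [Field k] [Field K] [Algebra k K]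
    (P : ∀ B : Subalgebra k K, Ideal ↥B → ℕ → Prop) (B : Subalgebra k K) (d : ℕ) (f : ↥B)
    (hf : (PrimeSpectrum.basicOpen f : Set (PrimeSpectrum ↥B)) ⊆ regularLocus ↥B) :
    f ∈ risoCen P B d := by
  simp only [risoCen, Submodule.mem_iInf, Set.mem_setOf_eq]
  rintro m ⟨hm, hnreg, -⟩
  by_contra hfm
  have hmem : (⟨m, hm.isPrime⟩ : PrimeSpectrum ↥B) ∈ regularLocus ↥B :=
    hf ((PrimeSpectrum.mem_basicOpen f _).mpr hfm)
  rw [mem_regularLocus] at hmem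
  exact hnreg hmem

/-- If `f` is a unit of `O` and `f · x⁻¹ ∈ O`, then `x⁻¹ ∈ O`. [folklore] -/
theorem persist_inv_mem_of_mul_inv_mem {K : Type} [Field K] {O : ValuationSubring K} {f xt : K}
    (hf : O.valuation f = 1) (h : f * xt⁻¹ ∈ O) : xt⁻¹ ∈ O := by
  rw [← O.valuation_le_one_iff] at h ⊢
  rwa [map_mul, hf, one_mul] at h

/-- **Persistence (stub `stub_rcrPersist` of crux `RisoCentresResolve`).** If the local ring of the
finitely generated chart `B ⊆ O` at the centre of the valuation ring `O` is regular, then an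
admissible blow-up chart does not change it: `risoLoc O (risoStep P B d x) = risoLoc O B`.
The regular locus of `B` is open (`k` perfect), so some `f ∉ 𝔪_O ∩ B` lies in every singular
maximal ideal, hence in `Cen`; admissibility (`f/x ∈ O`) then makes `x` a unit of `O`, and
`B ⊆ B[Cen/x] ⊆ B_{𝔪_O ∩ B}`. [folklore] -/
theorem stub_rcrPersist {k K : Type} [Field k] [IsAlgClosed k] [Field K] [Algebra k K]
    (P : ∀ B : Subalgebra k K, Ideal ↥B → ℕ → Prop) (O : ValuationSubring K)
    (B : Subalgebra k K) (hB : B.FG) (hBO : B.toSubring ≤ O.toSubring) (d : ℕ) (xt : K)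
    (hV : risoValid P O B d xt) (hreg : IsRegularLocalRing ↥(risoLoc O B)) :
    risoLoc O (risoStep P B d xt) = risoLoc O B := by
  obtain ⟨-, ⟨x, -, hxeq⟩, hadm⟩ := hV
  obtain ⟨f, hfv, hfU⟩ := persist_exists_basicOpen_subset_regularLocus hB hBO hreg
  have hfCen : f ∈ risoCen P B d := persist_mem_risoCen_of_basicOpen_subset P B d f hfU
  have hxtO : xt⁻¹ ∈ O := persist_inv_mem_of_mul_inv_mem hfv (hadm f hfCen)
  have hxtB : xt ∈ B := hxeq ▸ x.2
  exact risoLoc_eq_of_le_of_le hBO (le_risoStep P B d xt) (risoStep_le_risoLoc O hxtB hxtO)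

end Summit.ResolutionOfSingularities.ResolutionOfSingularities.Theorems

end
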